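import Mathlib
import Summits.PneNP.PneNP.Theorems.Nc03AvoidResidualCoreReductionSolveKit
import Summits.PneNP.PneNP.Theorems.Nc03AvoidResidualCoreReductionEasy

/-!
# Route Nc03AvoidResidualCore, item `ResidualCoreReduction` — the solver, IV: classes `0`, `1`, `2`

Helper file for `stmt-PneNP-20227` (sequel of `…ReductionSolveKit`; cell pnp-ideate). Polynomial
time solvers for the pure classes `0` (constant), `1` (dictator) and `2` (`AND₂`) on raw pure
instances, each with: the program `solC : PRaw → List Bool`, its output length, its CORRECTNESS on
`rawOf J` for pure `J` above the class threshold (via `cert·_exists` / `cert·_sound` of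
`…ReductionEasy`), and its polynomial-time computability in the `CodeFP` algebra (a search over
tuples of enumerated triples, `codeFP_searchIndic`).
-/

set_option linter.dupNamespace false -- `Summit.PneNP.PneNP.…`: summit = sub-problem name (D-0017 single-conjunct layout)

namespace Summit.PneNP.PneNP.Theorems.Nc03Reduction

open Literature.Computability.Complexity CodeFP

variable {N M : ℕ}

/-! ## Class 0: constant outputs -/

/-- Solver, class `0`: all ones. -/
def sol0 (pr : PRaw) : List Bool := (List.range pr.2.1).map fun _ => true

/-- Output length, class `0`. -/
@[simp] theorem length_sol0 (pr : PRaw) : (sol0 pr).length = pr.2.1 := by simp [sol0]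

/-- Correctness, class `0`. -/
theorem sol0_correct (J : LocalMap 3 N M) (hP : J.IsPure (rep 0)) (hM : 0 < M) :
    (fun p : Fin M => (sol0 (rawOf J)).getD p.val false) ∉ J.range := by
  refine cert0_sound hP ⟨0, hM⟩ ?_
  simp only [sol0, rawOf_M]
  rw [List.getD_eq_getElem?_getD, List.getElem?_map, List.getElem?_range hM]
  rfl

/-- Polynomial time, class `0`. -/
theorem codeFP_sol0 : CodeFP prE (rawE bitE) sol0 :=
  ((map (σ := Unit) (eσ := unitE) (eα := natE) (g := fun _ => true) (const _ true)).comp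
    ((const prE ()).pair (urange.comp codeFP_M))).congr fun _ => rfl

/-! ## Class 1: dictator outputs -/

/-- Test, class `1`: two distinct outputs with the same head variable. -/
def test1 (x : ETrip × ETrip) : Bool := !decide (x.1.1 = x.2.1) && decide (x.1.2.1 = x.2.2.1)

/-- Solver, class `1`: switch on the first of two outputs copying the same variable. -/
def sol1 (pr : PRaw) : List Bool :=
  searchOut pr.2.1 ((((enumT pr).product (enumT pr)).find? test1).map fun x => [x.1.1])

/-- Output length, class `1`. -/
@[simp] theorem length_sol1 (pr : PRaw) : (sol1 pr).length = pr.2.1 := by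
  unfold sol1; simp

/-- Correctness, class `1`. -/
theorem sol1_correct (J : LocalMap 3 N M) (hP : J.IsPure (rep 1)) (hM : N < M) :
    (fun p : Fin M => (sol1 (rawOf J)).getD p.val false) ∉ J.range := by
  obtain ⟨j, j', hne, heq⟩ := cert1_exists J hM
  have hx₀ : test1 ((j.val, tripOf J j), (j'.val, tripOf J j')) = true := by
    have : j.val ≠ j'.val := fun h => hne (Fin.ext h)
    simp [test1, this, heq]
  have hmem : ((j.val, tripOf J j), (j'.val, tripOf J j')) ∈ (enumT (rawOf J)).product (enumT (rawOf J)) :=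
    List.pair_mem_product.2 ⟨mem_enumT J j, mem_enumT J j'⟩
  cases h : ((enumT (rawOf J)).product (enumT (rawOf J))).find? test1 with
  | none => exact absurd hx₀ (by have := List.find?_eq_none.1 h _ hmem; simpa using this)
  | some x =>
    obtain ⟨x1, x2⟩ := x
    have hx := List.find?_some h
    obtain ⟨h1, h2⟩ := List.pair_mem_product.1 (List.mem_of_find?_eq_some h)
    obtain ⟨p, rfl⟩ := (mem_enumT_iff J).1 h1
    obtain ⟨p', rfl⟩ := (mem_enumT_iff J).1 h2
    simp only [test1, Bool.and_eq_true, Bool.not_eq_true', decide_eq_false_iff_not, decide_eq_true_eq,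
      tripOf_fst] at hx
    have hsol : sol1 (rawOf J) = indic M [p.val] := by unfold sol1; rw [h]; rfl
    refine cert1_sound hP (j := p) (j' := p') (vars_eq_of_val_eq J hx.2) ?_
    show (sol1 (rawOf J)).getD p.val false ≠ (sol1 (rawOf J)).getD p'.val false
    rw [hsol, indic_at, indic_at]
    have : p'.val ≠ p.val := fun e => hx.1 e.symm
    simp [this]

/-- Polynomial time, class `1`. -/
theorem codeFP_sol1 : CodeFP prE (rawE bitE) sol1 := by
  have hc : CodeFP prE (rawE (pairE etE etE)) (fun pr => (enumT pr).product (enumT pr)) :=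
    (rawProduct etE etE).comp (codeFP_enumT.pair codeFP_enumT)
  have ht : CodeFP (pairE etE etE) bitE test1 :=
    ((codeFP_eqTest (fst _ _).fst' (snd _ _).fst').not.and
      (codeFP_eqTest (fst _ _).snd'.fst' (snd _ _).snd'.fst')).congr fun _ => rfl
  have hr : CodeFP (pairE etE etE) (rawE natE) (fun x => [x.1.1]) := (rawSingleton natE).comp (fst _ _).fst'
  exact (codeFP_searchOut hc ht hr).congr fun pr => by unfold sol1; rfl

/-! ## Class 2: `AND₂` outputs -/

/-- Test, class `2`, on `(e, f, g)`: `f, g ≠ e`, `f` reads the role-`0` variable of `e`, `g` its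
role-`1` variable (in roles `0, 1`). -/
def test2 (x : ETrip × ETrip × ETrip) : Bool :=
  !decide (x.2.1.1 = x.1.1) && !decide (x.2.2.1 = x.1.1) &&
    (decide (x.1.2.1 = x.2.1.2.1) || decide (x.1.2.1 = x.2.1.2.2.1)) &&
    (decide (x.1.2.2.1 = x.2.2.2.1) || decide (x.1.2.2.1 = x.2.2.2.2.1))

/-- Solver, class `2`: switch on the two readers, off the read output. -/
def sol2 (pr : PRaw) : List Bool :=
  searchOut pr.2.1 ((((enumT pr).product ((enumT pr).product (enumT pr))).find? test2).map
    fun x => [x.2.1.1, x.2.2.1])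

/-- Output length, class `2`. -/
@[simp] theorem length_sol2 (pr : PRaw) : (sol2 pr).length = pr.2.1 := by
  unfold sol2; simp

/-- Correctness, class `2`. -/
theorem sol2_correct (J : LocalMap 3 N M) (hP : J.IsPure (rep 2)) (hM : N < M) :
    (fun p : Fin M => (sol2 (rawOf J)).getD p.val false) ∉ J.range := by
  obtain ⟨e, f, g, hfe, hge, hf, hg⟩ := cert2_exists J hM
  set cands := (enumT (rawOf J)).product ((enumT (rawOf J)).product (enumT (rawOf J))) with hc
  have hx₀ : test2 ((e.val, tripOf J e), (f.val, tripOf J f), (g.val, tripOf J g)) = true := by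
    have h1 : f.val ≠ e.val := fun h => hfe (Fin.ext h)
    have h2 : g.val ≠ e.val := fun h => hge (Fin.ext h)
    simp only [rd2, Finset.mem_insert, Finset.mem_singleton] at hf hg
    simp only [test2, h1, h2, tripOf_fst, tripOf_snd_fst, decide_false, Bool.not_false, Bool.true_and,
      Bool.and_eq_true, Bool.or_eq_true, decide_eq_true_eq]
    exact ⟨by rcases hf with h | h <;> simp [h], by rcases hg with h | h <;> simp [h]⟩
  have hmem : ((e.val, tripOf J e), (f.val, tripOf J f), (g.val, tripOf J g)) ∈ cands :=
    List.pair_mem_product.2 ⟨mem_enumT J e, List.pair_mem_product.2 ⟨mem_enumT J f, mem_enumT J g⟩⟩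
  cases h : cands.find? test2 with
  | none => exact absurd hx₀ (by have := List.find?_eq_none.1 h _ hmem; simpa using this)
  | some x =>
    obtain ⟨xe, xf, xg⟩ := x
    have hx := List.find?_some h
    have hm := List.mem_of_find?_eq_some h
    obtain ⟨h1, h23⟩ := List.pair_mem_product.1 hm
    obtain ⟨h2, h3⟩ := List.pair_mem_product.1 h23
    obtain ⟨pe, rfl⟩ := (mem_enumT_iff J).1 h1
    obtain ⟨pf, rfl⟩ := (mem_enumT_iff J).1 h2
    obtain ⟨pg, rfl⟩ := (mem_enumT_iff J).1 h3
    simp only [test2, Bool.and_eq_true, Bool.or_eq_true, Bool.not_eq_true', decide_eq_false_iff_not,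
      decide_eq_true_eq, tripOf_fst, tripOf_snd_fst] at hx
    obtain ⟨⟨⟨hfe', hge'⟩, hf'⟩, hg'⟩ := hx
    have hsol : sol2 (rawOf J) = indic M [pf.val, pg.val] := by unfold sol2; rw [← hc, h]; rfl
    have hfm : J.vars pe 0 ∈ rd2 J pf := by
      simp only [rd2, Finset.mem_insert, Finset.mem_singleton]
      rcases hf' with h | h
      · exact Or.inl (vars_eq_of_val_eq J h)
      · exact Or.inr (vars_eq_of_val_eq J h)
    have hgm : J.vars pe 1 ∈ rd2 J pg := by
      simp only [rd2, Finset.mem_insert, Finset.mem_singleton]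
      rcases hg' with h | h
      · exact Or.inl (vars_eq_of_val_eq J h)
      · exact Or.inr (vars_eq_of_val_eq J h)
    refine cert2_sound hP hfm hgm ?_ ?_ ?_
    · show (sol2 (rawOf J)).getD pf.val false = true
      rw [hsol, indic_at]; simp
    · show (sol2 (rawOf J)).getD pg.val false = true
      rw [hsol, indic_at]; simp
    · show (sol2 (rawOf J)).getD pe.val false = false
      rw [hsol, indic_at]
      simp only [List.mem_cons, List.not_mem_nil, or_false, decide_eq_false_iff_not, not_or]
      exact ⟨fun h => hfe' h.symm, fun h => hge' h.symm⟩

/-- Polynomial time, class `2`. -/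
theorem codeFP_sol2 : CodeFP prE (rawE bitE) sol2 := by
  have hc : CodeFP prE (rawE (pairE etE (pairE etE etE)))
      (fun pr => (enumT pr).product ((enumT pr).product (enumT pr))) :=
    (rawProduct etE (pairE etE etE)).comp (codeFP_enumT.pair
      ((rawProduct etE etE).comp (codeFP_enumT.pair codeFP_enumT)))
  -- projections of `x = (e, f, g)`
  have pe : CodeFP (pairE etE (pairE etE etE)) etE (fun x => x.1) := fst _ _
  have pf : CodeFP (pairE etE (pairE etE etE)) etE (fun x => x.2.1) := (snd _ _).fst'
  have pg : CodeFP (pairE etE (pairE etE etE)) etE (fun x => x.2.2) := (snd _ _).snd'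
  have ht : CodeFP (pairE etE (pairE etE etE)) bitE test2 :=
    ((((codeFP_eqTest pf.fst' pe.fst').not.and (codeFP_eqTest pg.fst' pe.fst').not).and
      ((codeFP_eqTest pe.snd'.fst' pf.snd'.fst').or (codeFP_eqTest pe.snd'.fst' pf.snd'.snd'.fst'))).and
      ((codeFP_eqTest pe.snd'.snd'.fst' pg.snd'.fst').or
        (codeFP_eqTest pe.snd'.snd'.fst' pg.snd'.snd'.fst'))).congr fun _ => rfl
  have hr : CodeFP (pairE etE (pairE etE etE)) (rawE natE) (fun x => [x.2.1.1, x.2.2.1]) :=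
    ((rawCons natE).comp (pf.fst'.pair ((rawSingleton natE).comp pg.fst'))).congr fun _ => rfl
  exact (codeFP_searchOut hc ht hr).congr fun pr => by unfold sol2; rfl

end Summit.PneNP.PneNP.Theorems.Nc03Reduction
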